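import Summits.QuantumFields.BalabanUV.Beta.GAN24.LayerPushMoments
import Summits.QuantumFields.BalabanUV.Beta.GAN24.LayerPushFrozenSlice

/-!
# `BalabanUV.Beta.GAN24.LayerFrozenLabel` — binder row G-an2-4 / (CONV-C), W-slot CT-W, route «WC-TL» ∕ «QR-LL», row **(LT-Δ) «LAYER TRANSPORT»**, part (LT-3c), file 1 of 2 —
# THE FROZEN (CHARGED) TERM, ONE LABEL: the frozen leg product `a·b·c` (product rule twice) and its pairing against ONE per-label charge profile with (M0_y), (Π_y)
# (file 2 = `GAN24/LayerFrozenCount`: the count over labels with a free second-difference scale; split off for the gate's size cap — statements unchanged)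

NOT IN PRINT; OUR BOOKKEEPING ([folklore] `LayerPushMoments` (second-order Taylor, one-label pairing, product rule) ⨾ `LayerPushFrozenSlice.exp_wobble`; G-an2-4 formalisation swarm,
leaf prover `b2b-balaban-gan24-formalise-leaf-01`, gen 63 ∕ 64).  HONEST FRAMING (cell contract, verbatim): «discharging `BetaPertH` makes Bałaban's UV stability UNCONDITIONAL — a
real constructive-QFT result; it is NOT the continuum limit and NOT the Clay problem.»  HONEST DEPENDENCY (verbatim): «continuum YM on T⁴ ⇐ BetaPertH ∧ nine spine estimates (0/9
proved); BetaPertH ⇐ (D1) ∧ (D4) ∧ CAP+tail; G-an2-4 gates asym, D1 and NE2/3/4.»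

## What (generic `d`; GENERIC slot functions given by envelopes — no object of an2's typed system occurs; the second-difference allowances `ha, hb, hc` are FREE)
§0 `leg_rel_grad`, `leg_rel_second` (coarse unit-gradient ∕ unit-second-difference envelopes seen from a base point), `exp_rate_mono`.
§1 the frozen leg product `F = a·b·c`: `abs_prod3_le` (sup at the quadrupled rate), **`abs_second_diff_prod3_le`** (`|∇_j∇_i(abc)| ≤ σ₃·e^{4κ‖p−y‖₁}`, every monomial of `σ₃` of
   total derivative weight two), **`prod3_grad_lipschitz`** (the §1 hypothesis of `LayerPushMoments`).
§2 **`abs_frozen_label_le`** — ONE label: `|Σ'_e a·b·c·Z_y| ≤ σ₃·B·(8∕(δ−4κ)²)·Zl((δ−4κ)∕4)` under (M0_y) `Σ'_e Z_y e = 0`, (Π_y) `Σ'_e (e−y)_i Z_y e = 0` — NO sup-only and NO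
   single-gradient monomial survives.
[folklore]; 0 cited facts, 0 `def`, 0 `def … : Prop`, 0 sorry.  Asserts NOTHING about which σ-letters satisfy (M0_y)∕(Π_y) (the charge audit E15); NEVER «G-an2-4 closed» as
(CONV-C); NOT D1, NOT `BetaPertH`, NOT continuum, NOT Clay.  2026-08-22.
-/

noncomputable section

open Finset
open scoped BigOperators
open Literature.MathematicalPhysics.QuantumFieldTheory
open Literature.MathematicalPhysics.QuantumFieldTheory.Balaban1983to89
open Literature.MathematicalPhysics.QuantumFieldTheory.Balaban1983to89.Beta
open B12Sec2to5 (l1 l1_nonneg)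
open ExpKernelCalculus (Site Zl Zl_nonneg Zl_pos summable_exp_shift' tsum_exp_shift' l1_sub_triangle l1_sub_symm)
open LatticeForm (quo)
open Summit.QuantumFields.BalabanUV.Beta.GAN24.LatticeFreeze (abs_sub_le_of_unit_steps)
open Summit.QuantumFields.BalabanUV.Beta.GAN24.LayerPushFrozenSlice (exp_wobble leg_rel_sup)
open Summit.QuantumFields.BalabanUV.Beta.GAN24.LayerPushMoments (abs_tsum_mul_le_of_moments abs_second_diff_mul_le abs_diff_mul_le)
namespace Summit.QuantumFields.BalabanUV.Beta.GAN24.LayerFrozenLabel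

variable {d : ℕ}

/-! ## §0 Coarse unit-gradient and unit-second-difference envelopes seen from a base point -/

/-- [folklore] A coarse UNIT-GRADIENT envelope seen from the base point `y`: `|f (p+e_i) − f p| ≤ (A′·e^{−κ‖quo N y − c‖₁})·e^{κ‖p−y‖₁}`. -/
theorem leg_rel_grad {N : ℕ} (hN : 1 ≤ N) {κ A' : ℝ} (hκ : 0 ≤ κ) (hA' : 0 ≤ A') {f : (Fin (d + 1) → ℤ) → ℝ} {c : Fin (d + 1) → ℤ}
    (hf' : ∀ p i, |f (p + Pi.single i 1) - f p| ≤ A' * Real.exp (-κ * l1 (quo N p - c))) (y p : Fin (d + 1) → ℤ) (i : Fin (d + 1)) :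
    |f (p + Pi.single i 1) - f p| ≤ A' * Real.exp (-κ * l1 (quo N y - c)) * Real.exp (κ * l1 (p - y)) := by
  calc |f (p + Pi.single i 1) - f p| ≤ A' * Real.exp (-κ * l1 (quo N p - c)) := hf' p i
    _ ≤ A' * (Real.exp (κ * l1 (p - y)) * Real.exp (-κ * l1 (quo N y - c))) := mul_le_mul_of_nonneg_left (exp_wobble hN hκ p y c) hA'
    _ = _ := by ring

/-- [folklore] A coarse UNIT-SECOND-DIFFERENCE envelope seen from the base point `y`. -/
theorem leg_rel_second {N : ℕ} (hN : 1 ≤ N) {κ A'' : ℝ} (hκ : 0 ≤ κ) (hA'' : 0 ≤ A'') {f : (Fin (d + 1) → ℤ) → ℝ} {c : Fin (d + 1) → ℤ}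
    (hf'' : ∀ p i j, |(f (p + Pi.single i 1 + Pi.single j 1) - f (p + Pi.single j 1)) - (f (p + Pi.single i 1) - f p)|
      ≤ A'' * Real.exp (-κ * l1 (quo N p - c))) (y p : Fin (d + 1) → ℤ) (i j : Fin (d + 1)) :
    |(f (p + Pi.single i 1 + Pi.single j 1) - f (p + Pi.single j 1)) - (f (p + Pi.single i 1) - f p)|
      ≤ A'' * Real.exp (-κ * l1 (quo N y - c)) * Real.exp (κ * l1 (p - y)) := by
  calc _ ≤ A'' * Real.exp (-κ * l1 (quo N p - c)) := hf'' p i j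
    _ ≤ A'' * (Real.exp (κ * l1 (p - y)) * Real.exp (-κ * l1 (quo N y - c))) := mul_le_mul_of_nonneg_left (exp_wobble hN hκ p y c) hA''
    _ = _ := by ring

/-- [folklore] Weakening the growth rate of a relative envelope: `e^{κ‖p−y‖₁} ≤ e^{κ′‖p−y‖₁}` for `κ ≤ κ′`. -/
theorem exp_rate_mono {κ κ' : ℝ} (h : κ ≤ κ') (v : Fin (d + 1) → ℤ) : Real.exp (κ * l1 v) ≤ Real.exp (κ' * l1 v) :=
  Real.exp_le_exp.2 (mul_le_mul_of_nonneg_right h (l1_nonneg v))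

/-! ## §1 The frozen leg product `F = a·b·c`: sup and gradient-Lipschitz allowances from the factors' three envelopes -/

section Product3

variable {a b c : (Fin (d + 1) → ℤ) → ℝ} {y : Fin (d + 1) → ℤ} {κ pa ga ha pb gb hb pc gc hc : ℝ}
  (hκ : 0 ≤ κ) (hpa : 0 ≤ pa) (hga : 0 ≤ ga) (hha : 0 ≤ ha) (hpb : 0 ≤ pb) (hgb : 0 ≤ gb) (hhb : 0 ≤ hb)
  (hpc : 0 ≤ pc) (hgc : 0 ≤ gc) (hhc : 0 ≤ hc)
  (ha0 : ∀ p, |a p| ≤ pa * Real.exp (κ * l1 (p - y)))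
  (ha1 : ∀ p i, |a (p + Pi.single i 1) - a p| ≤ ga * Real.exp (κ * l1 (p - y)))
  (ha2 : ∀ p i j, |(a (p + Pi.single i 1 + Pi.single j 1) - a (p + Pi.single j 1)) - (a (p + Pi.single i 1) - a p)| ≤ ha * Real.exp (κ * l1 (p - y)))
  (hb0 : ∀ p, |b p| ≤ pb * Real.exp (κ * l1 (p - y)))
  (hb1 : ∀ p i, |b (p + Pi.single i 1) - b p| ≤ gb * Real.exp (κ * l1 (p - y)))
  (hb2 : ∀ p i j, |(b (p + Pi.single i 1 + Pi.single j 1) - b (p + Pi.single j 1)) - (b (p + Pi.single i 1) - b p)| ≤ hb * Real.exp (κ * l1 (p - y)))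
  (hc0 : ∀ p, |c p| ≤ pc * Real.exp (κ * l1 (p - y)))
  (hc1 : ∀ p i, |c (p + Pi.single i 1) - c p| ≤ gc * Real.exp (κ * l1 (p - y)))
  (hc2 : ∀ p i j, |(c (p + Pi.single i 1 + Pi.single j 1) - c (p + Pi.single j 1)) - (c (p + Pi.single i 1) - c p)| ≤ hc * Real.exp (κ * l1 (p - y)))

include hκ hpa hpb hpc ha0 hb0 hc0 in
/-- [folklore] The sup of the triple product at the quadrupled rate: `|a·b·c| ≤ pa·pb·pc·e^{4κ‖p−y‖₁}`. -/
theorem abs_prod3_le (p : Fin (d + 1) → ℤ) : |a p * b p * c p| ≤ pa * pb * pc * Real.exp (4 * κ * l1 (p - y)) := by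
  rw [abs_mul, abs_mul]
  set E := Real.exp (κ * l1 (p - y)) with hE
  have hE1 : 1 ≤ E := by have := Real.exp_le_exp.2 (show (0:ℝ) ≤ κ * l1 (p - y) by nlinarith [l1_nonneg (p - y)]); rwa [Real.exp_zero] at this
  have h3 : E * E * E ≤ Real.exp (4 * κ * l1 (p - y)) := by
    have e : Real.exp (4 * κ * l1 (p - y)) = E * E * E * E := by
      rw [hE, ← Real.exp_add, ← Real.exp_add, ← Real.exp_add]; congr 1; ring
    rw [e]; exact le_mul_of_one_le_right (by positivity) hE1
  calc |a p| * |b p| * |c p| ≤ (pa * E) * (pb * E) * (pc * E) :=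
        mul_le_mul (mul_le_mul (ha0 p) (hb0 p) (abs_nonneg _) (by positivity)) (hc0 p) (abs_nonneg _) (by positivity)
    _ = pa * pb * pc * (E * E * E) := by ring
    _ ≤ pa * pb * pc * Real.exp (4 * κ * l1 (p - y)) := mul_le_mul_of_nonneg_left h3 (by positivity)

include hκ hpa hga hha hpb hgb hhb hpc hgc hhc ha0 ha1 ha2 hb0 hb1 hb2 hc0 hc1 hc2 in
/-- [folklore] **THE UNIT SECOND DIFFERENCES OF THE TRIPLE PRODUCT** (the product rule `LayerPushMoments.abs_second_diff_mul_le` twice, rates `κ → 2κ → 4κ`):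
`|∇_j∇_i(abc)(p)| ≤ σ₃·e^{4κ‖p−y‖₁}`, `σ₃ = ((ha·pb + 2ga·gb + pa·hb)·e^{2κ}·pc + 2·(ga·pb + pa·gb)·e^{κ}·gc + pa·pb·hc)·e^{4κ}` — every monomial has total
«derivative weight» two (one `h` or two `g`'s). -/
theorem abs_second_diff_prod3_le (p : Fin (d + 1) → ℤ) (i j : Fin (d + 1)) :
    |(a (p + Pi.single i 1 + Pi.single j 1) * b (p + Pi.single i 1 + Pi.single j 1) * c (p + Pi.single i 1 + Pi.single j 1)
        - a (p + Pi.single j 1) * b (p + Pi.single j 1) * c (p + Pi.single j 1))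
      - (a (p + Pi.single i 1) * b (p + Pi.single i 1) * c (p + Pi.single i 1) - a p * b p * c p)|
      ≤ (((ha * pb + 2 * ga * gb + pa * hb) * Real.exp (2 * κ) * pc + 2 * ((ga * pb + pa * gb) * Real.exp κ) * gc + pa * pb * hc)
          * Real.exp (2 * (2 * κ))) * Real.exp (2 * (2 * κ) * l1 (p - y)) := by
  -- the pair `ab` at rate 2κ
  have hκ2 : 0 ≤ 2 * κ := by linarith
  have hw : ∀ q, Real.exp (κ * l1 (q - y)) ≤ Real.exp (2 * κ * l1 (q - y)) := fun q => exp_rate_mono (by linarith) _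
  have hab0 : ∀ q, |a q * b q| ≤ (pa * pb) * Real.exp (2 * κ * l1 (q - y)) := by
    intro q
    rw [abs_mul]
    calc |a q| * |b q| ≤ (pa * Real.exp (κ * l1 (q - y))) * (pb * Real.exp (κ * l1 (q - y))) :=
          mul_le_mul (ha0 q) (hb0 q) (abs_nonneg _) (by positivity)
      _ = (pa * pb) * Real.exp (2 * κ * l1 (q - y)) := by rw [show 2 * κ * l1 (q - y) = κ * l1 (q - y) + κ * l1 (q - y) by ring, Real.exp_add]; ring
  have hab1 : ∀ q k, |a (q + Pi.single k 1) * b (q + Pi.single k 1) - a q * b q| ≤ ((ga * pb + pa * gb) * Real.exp κ) * Real.exp (2 * κ * l1 (q - y)) :=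
    fun q k => abs_diff_mul_le hκ hpa hgb hpb ha0 ha1 hb0 hb1 q k
  have hab2 : ∀ q k k', |(a (q + Pi.single k 1 + Pi.single k' 1) * b (q + Pi.single k 1 + Pi.single k' 1) - a (q + Pi.single k' 1) * b (q + Pi.single k' 1))
      - (a (q + Pi.single k 1) * b (q + Pi.single k 1) - a q * b q)|
      ≤ ((ha * pb + 2 * ga * gb + pa * hb) * Real.exp (2 * κ)) * Real.exp (2 * κ * l1 (q - y)) :=
    fun q k k' => abs_second_diff_mul_le hκ hpa hga hha hpb hgb hhb ha0 ha1 ha2 hb0 hb1 hb2 q k k'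
  -- `c` at rate 2κ
  have hc0' : ∀ q, |c q| ≤ pc * Real.exp (2 * κ * l1 (q - y)) := fun q => (hc0 q).trans (mul_le_mul_of_nonneg_left (hw q) hpc)
  have hc1' : ∀ q k, |c (q + Pi.single k 1) - c q| ≤ gc * Real.exp (2 * κ * l1 (q - y)) := fun q k => (hc1 q k).trans (mul_le_mul_of_nonneg_left (hw q) hgc)
  have hc2' : ∀ q k k', |(c (q + Pi.single k 1 + Pi.single k' 1) - c (q + Pi.single k' 1)) - (c (q + Pi.single k 1) - c q)| ≤ hc * Real.exp (2 * κ * l1 (q - y)) :=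
    fun q k k' => (hc2 q k k').trans (mul_le_mul_of_nonneg_left (hw q) hhc)
  -- the product `(ab)·c` at rate 2κ → 4κ
  have h := abs_second_diff_mul_le (a := fun q => a q * b q) (b := c) (y := y) (κ := 2 * κ) hκ2 (by positivity) (by positivity) (by positivity)
    hpc hgc hhc hab0 hab1 hab2 hc0' hc1' hc2' p i j
  exact h

include hκ hpa hga hha hpb hgb hhb hpc hgc hhc ha0 ha1 ha2 hb0 hb1 hb2 hc0 hc1 hc2 in
/-- [folklore] **THE FROZEN LEG PRODUCT IS GRADIENT-LIPSCHITZ FROM THE BASE POINT** (the shape `LayerPushMoments.abs_sub_sub_lin_le_of_unit_steps` ∕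
`abs_tsum_mul_le_of_moments` consume): with `σ₃` as in `abs_second_diff_prod3_le`,
`|(F(p+e_i) − F p) − (F(y+e_i) − F y)| ≤ σ₃·‖p−y‖₁·e^{4κ‖p−y‖₁}`, `F = a·b·c`. -/
theorem prod3_grad_lipschitz (p : Fin (d + 1) → ℤ) (i : Fin (d + 1)) :
    |(a (p + Pi.single i 1) * b (p + Pi.single i 1) * c (p + Pi.single i 1) - a p * b p * c p)
        - (a (y + Pi.single i 1) * b (y + Pi.single i 1) * c (y + Pi.single i 1) - a y * b y * c y)|
      ≤ (((ha * pb + 2 * ga * gb + pa * hb) * Real.exp (2 * κ) * pc + 2 * ((ga * pb + pa * gb) * Real.exp κ) * gc + pa * pb * hc)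
          * Real.exp (2 * (2 * κ))) * l1 (p - y) * Real.exp (2 * (2 * κ) * l1 (p - y)) := by
  set F : (Fin (d + 1) → ℤ) → ℝ := fun q => a q * b q * c q with hF
  set σ₃ : ℝ := ((ha * pb + 2 * ga * gb + pa * hb) * Real.exp (2 * κ) * pc + 2 * ((ga * pb + pa * gb) * Real.exp κ) * gc + pa * pb * hc)
          * Real.exp (2 * (2 * κ)) with hσ₃
  have hσ₃0 : 0 ≤ σ₃ := by rw [hσ₃]; positivity
  have h := abs_sub_le_of_unit_steps (f := fun q => F (q + Pi.single i 1) - F q) (u := y) (γ := σ₃) (κ := 2 * (2 * κ)) hσ₃0 (by positivity)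
    (fun q j => by
      have h2 := abs_second_diff_prod3_le hκ hpa hga hha hpb hgb hhb hpc hgc hhc ha0 ha1 ha2 hb0 hb1 hb2 hc0 hc1 hc2 q i j
      have e : F (q + Pi.single j 1 + Pi.single i 1) - F (q + Pi.single j 1) - (F (q + Pi.single i 1) - F q)
          = (a (q + Pi.single i 1 + Pi.single j 1) * b (q + Pi.single i 1 + Pi.single j 1) * c (q + Pi.single i 1 + Pi.single j 1)
              - a (q + Pi.single j 1) * b (q + Pi.single j 1) * c (q + Pi.single j 1))
            - (a (q + Pi.single i 1) * b (q + Pi.single i 1) * c (q + Pi.single i 1) - a q * b q * c q) := by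
        rw [hF]; simp only [add_right_comm q (Pi.single j 1) (Pi.single i 1)]
      show |F (q + Pi.single j 1 + Pi.single i 1) - F (q + Pi.single j 1) - (F (q + Pi.single i 1) - F q)| ≤ _
      rw [e, hσ₃]; exact h2) p
  rw [hσ₃] at h
  simpa [hF] using h

end Product3

/-! ## §2 One label: the frozen pairing of the leg product against a charge profile with (M0), (Π) -/

section Label

variable {a b c Z : (Fin (d + 1) → ℤ) → ℝ} {y : Fin (d + 1) → ℤ} {κ δ B pa ga ha pb gb hb pc gc hc : ℝ}
  (hκ : 0 ≤ κ) (hκδ : 4 * κ < δ) (hpa : 0 ≤ pa) (hga : 0 ≤ ga) (hha : 0 ≤ ha) (hpb : 0 ≤ pb) (hgb : 0 ≤ gb) (hhb : 0 ≤ hb)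
  (hpc : 0 ≤ pc) (hgc : 0 ≤ gc) (hhc : 0 ≤ hc)
  (ha0 : ∀ p, |a p| ≤ pa * Real.exp (κ * l1 (p - y)))
  (ha1 : ∀ p i, |a (p + Pi.single i 1) - a p| ≤ ga * Real.exp (κ * l1 (p - y)))
  (ha2 : ∀ p i j, |(a (p + Pi.single i 1 + Pi.single j 1) - a (p + Pi.single j 1)) - (a (p + Pi.single i 1) - a p)| ≤ ha * Real.exp (κ * l1 (p - y)))
  (hb0 : ∀ p, |b p| ≤ pb * Real.exp (κ * l1 (p - y)))
  (hb1 : ∀ p i, |b (p + Pi.single i 1) - b p| ≤ gb * Real.exp (κ * l1 (p - y)))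
  (hb2 : ∀ p i j, |(b (p + Pi.single i 1 + Pi.single j 1) - b (p + Pi.single j 1)) - (b (p + Pi.single i 1) - b p)| ≤ hb * Real.exp (κ * l1 (p - y)))
  (hc0 : ∀ p, |c p| ≤ pc * Real.exp (κ * l1 (p - y)))
  (hc1 : ∀ p i, |c (p + Pi.single i 1) - c p| ≤ gc * Real.exp (κ * l1 (p - y)))
  (hc2 : ∀ p i j, |(c (p + Pi.single i 1 + Pi.single j 1) - c (p + Pi.single j 1)) - (c (p + Pi.single i 1) - c p)| ≤ hc * Real.exp (κ * l1 (p - y)))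
  (hZ : ∀ e, |Z e| ≤ B * Real.exp (-δ * l1 (e - y)))
  (hM0 : ∑' e, Z e = 0) (hP1 : ∀ i : Fin (d + 1), ∑' e, (((e - y) i : ℤ) : ℝ) * Z e = 0)

include hκ hκδ hpa hga hha hpb hgb hhb hpc hgc hhc ha0 ha1 ha2 hb0 hb1 hb2 hc0 hc1 hc2 hZ hM0 hP1 in
/-- NOT IN PRINT; OUR BOOKKEEPING (§1 ⨾ `LayerPushMoments.abs_tsum_mul_le_of_moments`).  **ONE LABEL's FROZEN PAIRING IS SECOND ORDER IN THE LEGS**: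
`|Σ'_e a e·b e·c e·Z e| ≤ σ₃·B·(8∕(δ−4κ)²)·Zl((δ−4κ)∕4)` with `σ₃` the second-difference allowance of the leg product (§1) — NO sup-only and NO single-gradient
monomial survives: the charge's (M0) and (Π) eat them. -/
theorem abs_frozen_label_le :
    |∑' e, (a e * b e * c e) * Z e|
      ≤ (((ha * pb + 2 * ga * gb + pa * hb) * Real.exp (2 * κ) * pc + 2 * ((ga * pb + pa * gb) * Real.exp κ) * gc + pa * pb * hc)
          * Real.exp (2 * (2 * κ))) * B * (8 / (δ - 2 * (2 * κ)) ^ 2 * Zl (d + 1) ((δ - 2 * (2 * κ)) / 4)) := by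
  have hκ4 : 2 * (2 * κ) < δ := by linarith
  exact abs_tsum_mul_le_of_moments (F := fun e => a e * b e * c e) (Z := Z) (y := y) (pF := pa * pb * pc) hκ4 (by positivity) (by positivity)
    (by positivity)
    (fun p i => prod3_grad_lipschitz hκ hpa hga hha hpb hgb hhb hpc hgc hhc ha0 ha1 ha2 hb0 hb1 hb2 hc0 hc1 hc2 p i)
    (fun e => by
      have h := abs_prod3_le hκ hpa hpb hpc ha0 hb0 hc0 e
      rw [show 4 * κ * l1 (e - y) = 2 * (2 * κ) * l1 (e - y) by ring] at h
      exact h)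
    hZ hM0 hP1

end Label

end Summit.QuantumFields.BalabanUV.Beta.GAN24.LayerFrozenLabel

end
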